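import Literature.NumberTheory.Automorphic.ArchChartNormPairs                    -- ★ (PARTNER) P1 (+ atlases, `coe_gprimeSplitGL_eq_conj_diagonal`, `isUnit_det_cayB_submatrix`)
import Literature.LinearAlgebra.Matrix.Diagonalization                          -- ★ `exists_conj_eq_diagonal_of_nodup_roots'`
import Literature.LinearAlgebra.Matrix.HermitianCongruenceInertia               -- ★ Sylvester: `card_pos_eq_of_conjTranspose_mul_diagonal_mul`
import HarnessLib

/-!
# Regular normal forms in `U(diag e)(ℂ)`, rank 3 — every regular unitary matrix is `U`-conjugate to a chart element ((PARTNER) P2a = (EXH-G′) local, compact case;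
# Rogawski 1990 §3.1, §3.6; Knapp 1986 V §3; Horn–Johnson 1.3.9, 4.5.8)

Topic `NumberTheory/Automorphic`; namespace `Literature.NumberTheory.Automorphic.UnitaryGroup`.  THEOREMS ONLY (no `def`, no instance, no notation, no axiom, no
named fact, no `sorry`).  Cell `pub/hodgecm-mathlib`, crux H413 (`stmt-HodgeConjecture-24833`), F0∕P3c line LH3, DIRECT ROAD of `stub_N9`; seat LH3-p03 (g2); organ
(PARTNER) of LH3-plan (g2), part P2 = (EXH-G′) of the cut 06:3xZ — LOCAL half, COMPACT case: a regular semisimple element of `U(diag e)(ℂ)` (`e` real, `e_i ≠ 0`) all of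
whose eigenvalues are unit is `U(diag e)`-conjugate to a compact chart element `gprimeCptGL τ c` (ANY slot order `τ`).  The split case and the global assembly on
`G′_∞` are the sibling files.  Count-neutral.

THE MATHEMATICS (frame normalisation, the rank-3 twin of ★ `ArchPlaneRegularDichotomy`).  Let `J = diag(e)`, `γᴴ J γ = J`, `χ_γ` separable.  ★ Horn–Johnson 1.3.9
(`exists_conj_eq_diagonal_of_nodup_roots'`): `γ S = S diag(d)` with `S` invertible, `d` injective.  The Gram matrix `Q = Sᴴ J S` of the eigenframe is Hermitian,
invertible, and satisfies the FRAME RELATION `(d̄_i d_j − 1) Q_ij = 0` (`sub_one_mul_frameGram_apply_eq_zero_three`).  If all `|d_i| = 1`, then `d̄_i d_j = d_j ∕ d_i ≠ 1`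
for `i ≠ j`, so `Q = diag(q)` is real diagonal, and by SYLVESTER (★ `card_pos_eq_of_conjTranspose_mul_diagonal_mul`) `q` and `e` have the same number of positive
entries; choose a bijection `σ : lines → eigen-indices` matching signs (`exists_perm_pos_iff`), rescale `v_i ↦ c_i v_i`, `c_i² q_i = e_{σ⁻¹ i}`; the frame
`V = (S diag c)∘σ` has `Vᴴ J V = J` (so `V ∈ U(J)`) and `γ V = V diag(d ∘ σ)`, i.e. **`γ = V · gprimeCptGL τ c · V⁻¹`** with `e^{i c_k} = d_{σ(τ k)}`
(`exists_unitary_conj_gprimeCptGL`).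
* §1 algebra: `sub_one_mul_frameGram_apply_eq_zero_three`, `frameGram_conjTranspose`, `exists_perm_pos_iff`, `mul_submatrix_id`, `conjTranspose_submatrix_mul_mul_submatrix`;
* §2 **`exists_unitary_conj_gprimeCptGL`**.
HONEST LABEL: HC_CM is proved only modulo the 7 printed citations (2 remaining: hLiu418 = `stmt-HodgeConjecture-24832`, h413 = `stmt-HodgeConjecture-24833`) until rung 0
closes; chart bookkeeping, count-neutral (+0∕+0).

## References
* [Rogawski1990] J. D. Rogawski, *Automorphic Representations of Unitary Groups in Three Variables*, Ann. of Math. Stud. 123 (1990), §3.1 p. 19, §3.6 p. 31.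
* [Knapp1986] A. W. Knapp, *Representation Theory of Semisimple Groups* (1986), Ch. V §3 (every regular element lies in a Cartan subgroup).
* [HornJohnson2013] R. A. Horn, C. R. Johnson, *Matrix Analysis*, 2nd ed. (2013), Thm. 1.3.9 (distinct eigenvalues ⇒ diagonalisable), Thm. 4.5.8 (Sylvester).
-/

set_option autoImplicit false

noncomputable section

open NumberField NumberField.InfinitePlace Matrix Complex Polynomial
open scoped MatrixGroups Matrix ComplexConjugate Real Classical

namespace Literature.NumberTheory.Automorphic.UnitaryGroup

/-! ## §1 Frame algebra -/

section Frame

variable {n : Type*} [Fintype n] [DecidableEq n]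

/-- **The frame relation**: if `γᴴ J γ = J` and `γ S = S · diag(d)`, the Gram matrix `Q = Sᴴ J S` satisfies `(d̄_i d_j − 1) Q_ij = 0`. [cite: Rogawski1990, §3.1 p. 19]
[cite: HornJohnson2013, Thm 1.3.9] -/
theorem sub_one_mul_frameGram_apply_eq_zero_three {γ J S : Matrix n n ℂ} {d : n → ℂ} (hU : γᴴ * J * γ = J) (hS : γ * S = S * Matrix.diagonal d) (i j : n) :
    ((starRingEnd ℂ) (d i) * d j - 1) * (Sᴴ * J * S) i j = 0 := by
  have hQ : (Matrix.diagonal d)ᴴ * (Sᴴ * J * S) * Matrix.diagonal d = Sᴴ * J * S := by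
    calc (Matrix.diagonal d)ᴴ * (Sᴴ * J * S) * Matrix.diagonal d = (S * Matrix.diagonal d)ᴴ * J * (S * Matrix.diagonal d) := by
          rw [Matrix.conjTranspose_mul S (Matrix.diagonal d)]; simp only [Matrix.mul_assoc]
      _ = (γ * S)ᴴ * J * (γ * S) := by rw [hS]
      _ = Sᴴ * (γᴴ * J * γ) * S := by rw [Matrix.conjTranspose_mul γ S]; simp only [Matrix.mul_assoc]
      _ = Sᴴ * J * S := by rw [hU]
  have h := congrFun (congrFun hQ i) j
  rw [Matrix.diagonal_conjTranspose, Matrix.mul_diagonal, Matrix.diagonal_mul] at h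
  have hs : (star d) i = (starRingEnd ℂ) (d i) := rfl
  rw [hs] at h
  linear_combination h

/-- The Gram matrix of a frame for a REAL diagonal form is Hermitian: `(Sᴴ diag(e) S)ᴴ = Sᴴ diag(e) S`. [cite: HornJohnson2013, Thm 4.5.8] -/
theorem frameGram_conjTranspose (S : Matrix n n ℂ) (e : n → ℝ) :
    (Sᴴ * Matrix.diagonal (fun i => (e i : ℂ)) * S)ᴴ = Sᴴ * Matrix.diagonal (fun i => (e i : ℂ)) * S := by
  have hstar : star (fun i => ((e i : ℝ) : ℂ)) = fun i => ((e i : ℝ) : ℂ) := funext fun i => Complex.conj_ofReal _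
  rw [Matrix.conjTranspose_mul, Matrix.conjTranspose_mul, Matrix.conjTranspose_conjTranspose, Matrix.diagonal_conjTranspose, hstar, ← Matrix.mul_assoc]

/-- Two sign patterns on `Fin 3` with the same number of positive entries are related by a permutation. [cite: HornJohnson2013, Thm 4.5.8] -/
theorem exists_perm_pos_iff {q e : Fin 3 → ℝ} (h : (Finset.univ.filter fun i => 0 < q i).card = (Finset.univ.filter fun i => 0 < e i).card) :
    ∃ σ : Equiv.Perm (Fin 3), ∀ ℓ, 0 < q (σ ℓ) ↔ 0 < e ℓ := by
  have key : ∀ f g : Fin 3 → Bool, (Finset.univ.filter fun i => f i = true).card = (Finset.univ.filter fun i => g i = true).card →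
      ∃ σ : Equiv.Perm (Fin 3), ∀ ℓ, f (σ ℓ) = g ℓ := by decide
  obtain ⟨σ, hσ⟩ := key (fun i => decide (0 < q i)) (fun i => decide (0 < e i)) (by simpa using h)
  exact ⟨σ, fun ℓ => by simpa using hσ ℓ⟩

omit [DecidableEq n] in
/-- `A · (X ∘ σ on columns) = (A X) ∘ σ on columns`. [folklore] [cite: HornJohnson2013, Thm 1.3.9] -/
theorem mul_submatrix_id (A X : Matrix n n ℂ) (σ : Equiv.Perm n) : A * X.submatrix id σ = (A * X).submatrix id σ := by
  have h := Matrix.submatrix_mul_equiv A X id (Equiv.refl n) σ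
  rw [Equiv.coe_refl, Matrix.submatrix_id_id] at h
  exact h

omit [DecidableEq n] in
/-- Gram matrix of a column-permuted frame: `(X∘σ)ᴴ J (X∘σ) = (Xᴴ J X)∘(σ, σ)`. [folklore] [cite: HornJohnson2013, Thm 4.5.8] -/
theorem conjTranspose_submatrix_mul_mul_submatrix (X J : Matrix n n ℂ) (σ : Equiv.Perm n) :
    (X.submatrix id σ)ᴴ * J * X.submatrix id σ = (Xᴴ * J * X).submatrix σ σ := by
  have h1 := Matrix.submatrix_mul_equiv Xᴴ (J * X) (σ : n → n) (Equiv.refl n) σ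
  rw [Equiv.coe_refl] at h1
  rw [Matrix.conjTranspose_submatrix, Matrix.mul_assoc, mul_submatrix_id J X σ, h1, Matrix.mul_assoc]

end Frame

/-! ## §2 The compact case: all eigenvalues unit -/

section Compact

/-- **COMPACT NORMAL FORM IN `U(diag e)(ℂ)`, RANK 3.**  A regular semisimple element `γ` of `U(diag e)(ℂ)` (`e` real, `e_i ≠ 0`) all of whose eigenvalues are unit is
`U(diag e)`-conjugate to a compact chart element `gprimeCptGL τ c` with pairwise distinct `e^{ic_k}` — for ANY slot order `τ` (the slot ↦ line assignment is absorbed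
by the choice of the sign-matching bijection `σ`). [cite: Rogawski1990, §3.1 p. 19; §3.6 p. 31] [cite: Knapp1986, Ch. V §3] [cite: HornJohnson2013, Thm 1.3.9, Thm 4.5.8] -/
theorem exists_unitary_conj_gprimeCptGL {e : Fin 3 → ℝ} (he : ∀ i, e i ≠ 0) {γ : GL (Fin 3) ℂ}
    (hγ : γ ∈ unitaryGroupOfForm (starRingEnd ℂ) (Matrix.diagonal fun i => (e i : ℂ)))
    (hsep : ((γ : Matrix (Fin 3) (Fin 3) ℂ)).charpoly.Separable)
    (hunit : ∀ z : ℂ, ((γ : Matrix (Fin 3) (Fin 3) ℂ)).charpoly.IsRoot z → ‖z‖ = 1) (τ : Equiv.Perm (Fin 3)) :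
    ∃ k : GL (Fin 3) ℂ, k ∈ unitaryGroupOfForm (starRingEnd ℂ) (Matrix.diagonal fun i => (e i : ℂ)) ∧
      ∃ c : Fin 3 → ℝ, Function.Injective (fun i : Fin 3 => Circle.exp (c i)) ∧ γ = k * gprimeCptGL τ c * k⁻¹ := by
  set J : Matrix (Fin 3) (Fin 3) ℂ := Matrix.diagonal fun i => (e i : ℂ) with hJ
  set G : Matrix (Fin 3) (Fin 3) ℂ := (γ : Matrix (Fin 3) (Fin 3) ℂ) with hG
  have hU : Gᴴ * J * G = J := by
    have h := mem_unitaryGroupOfForm_iff.1 hγ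
    rwa [transpose_map_starRingEnd_complex] at h
  -- eigenframe
  obtain ⟨S, d, hS, hSd, hroots⟩ := Literature.LinearAlgebra.Matrix.exists_conj_eq_diagonal_of_nodup_roots' G (Polynomial.nodup_roots hsep)
  have hGS : G * S = S * Matrix.diagonal d := by
    have h : S * (S⁻¹ * G * S) = S * Matrix.diagonal d := congrArg (fun X => S * X) hSd
    rw [← Matrix.mul_assoc, Matrix.mul_nonsing_inv_cancel_left _ _ hS] at h
    exact h
  -- the eigenvalues: roots of `χ_γ`, unit, pairwise distinct
  have hroot : ∀ i, (G.charpoly).IsRoot (d i) := by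
    intro i
    have hm : d i ∈ G.charpoly.roots := by rw [← hroots]; exact Multiset.mem_map_of_mem _ (Finset.mem_univ i)
    exact (Polynomial.mem_roots (fun h0 => by rw [h0] at hm; simp at hm)).1 hm
  have hd1 : ∀ i, ‖d i‖ = 1 := fun i => hunit (d i) (hroot i)
  have hdinj : Function.Injective d := by
    have hnd : (Finset.univ.val.map d).Nodup := by rw [hroots]; exact Polynomial.nodup_roots hsep
    exact (Multiset.nodup_map_iff_inj_on Finset.univ.nodup).1 hnd |> fun h i j hij => h i (Finset.mem_univ i) j (Finset.mem_univ j) hij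
  -- the Gram matrix of the frame is real diagonal
  set Q : Matrix (Fin 3) (Fin 3) ℂ := Sᴴ * J * S with hQ
  have hQoff : ∀ i j, i ≠ j → Q i j = 0 := by
    intro i j hij
    have h := sub_one_mul_frameGram_apply_eq_zero_three hU hGS i j
    rcases mul_eq_zero.1 h with h1 | h1
    · exfalso
      have hconj : (starRingEnd ℂ) (d i) = (d i)⁻¹ := (Complex.inv_eq_conj (hd1 i)).symm
      rw [hconj] at h1
      have hdi : d i ≠ 0 := fun h0 => by have := hd1 i; rw [h0, norm_zero] at this; exact zero_ne_one this
      have : d j = d i := by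
        have h2 : (d i)⁻¹ * d j = 1 := sub_eq_zero.1 h1
        calc d j = d i * ((d i)⁻¹ * d j) := by rw [← mul_assoc, mul_inv_cancel₀ hdi, one_mul]
          _ = d i := by rw [h2, mul_one]
      exact hij (hdinj this).symm
    · exact h1
  have hQherm : Qᴴ = Q := frameGram_conjTranspose S e
  have hQim : ∀ i, (Q i i).im = 0 := by
    intro i
    have h := congrFun (congrFun hQherm i) i
    rw [Matrix.conjTranspose_apply] at h
    exact Complex.conj_eq_iff_im.1 h
  set q : Fin 3 → ℝ := fun i => (Q i i).re with hq
  have hQdiag : Q = Matrix.diagonal fun i => (q i : ℂ) := by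
    ext i j
    by_cases hij : i = j
    · subst hij
      rw [Matrix.diagonal_apply_eq]
      exact Complex.ext (by simp [hq]) (by simp [hQim i])
    · rw [Matrix.diagonal_apply_ne _ hij, hQoff i j hij]
  -- `q_i ≠ 0` (`Q` is invertible)
  have hQdet : Q.det ≠ 0 := by
    rw [hQ, Matrix.det_mul, Matrix.det_mul, Matrix.det_conjTranspose, hJ, Matrix.det_diagonal]
    refine mul_ne_zero (mul_ne_zero ?_ ?_) hS.ne_zero
    · rw [ne_eq, star_eq_zero]; exact hS.ne_zero
    · exact Finset.prod_ne_zero_iff.2 fun i _ => Complex.ofReal_ne_zero.2 (he i)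
  have hq0 : ∀ i, q i ≠ 0 := by
    intro i h0
    apply hQdet
    rw [hQdiag, Matrix.det_diagonal]
    exact Finset.prod_eq_zero (Finset.mem_univ i) (by rw [h0, Complex.ofReal_zero])
  -- Sylvester: same number of positive entries
  haveI : Invertible S := Matrix.invertibleOfIsUnitDet S hS
  have hcard : (Finset.univ.filter fun i => 0 < q i).card = (Finset.univ.filter fun i => 0 < e i).card :=
    (Literature.LinearAlgebra.Matrix.card_pos_eq_of_conjTranspose_mul_diagonal_mul e q S (by rw [← hQdiag])).symm
  obtain ⟨σ, hσ⟩ := exists_perm_pos_iff hcard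
  -- the ratios `e_ℓ / q_{σ ℓ}` are positive
  have hratio : ∀ ℓ, 0 < e ℓ / q (σ ℓ) := by
    intro ℓ
    by_cases hpos : 0 < q (σ ℓ)
    · exact div_pos ((hσ ℓ).1 hpos) hpos
    · have hqneg : q (σ ℓ) < 0 := lt_of_le_of_ne (not_lt.1 hpos) (hq0 _)
      have heneg : e ℓ < 0 := lt_of_le_of_ne (not_lt.1 (fun h => hpos ((hσ ℓ).2 h))) (he ℓ)
      exact div_pos_of_neg_of_neg heneg hqneg
  -- rescaling `c_i = √(e_{σ⁻¹ i} / q_i)`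
  set cs : Fin 3 → ℝ := fun i => Real.sqrt (e (σ.symm i) / q i) with hcs
  have hcs2 : ∀ i, ((cs i : ℂ)) * (q i : ℂ) * (cs i : ℂ) = (e (σ.symm i) : ℂ) := by
    intro i
    have hr : 0 < e (σ.symm i) / q i := by simpa using hratio (σ.symm i)
    have h : cs i * q i * cs i = e (σ.symm i) := by
      have hsq : cs i * cs i = e (σ.symm i) / q i := by rw [hcs]; exact Real.mul_self_sqrt hr.le
      calc cs i * q i * cs i = (cs i * cs i) * q i := by ring
        _ = e (σ.symm i) := by rw [hsq]; field_simp [hq0 i]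
    exact_mod_cast h
  have hcs0 : ∀ i, (cs i : ℂ) ≠ 0 := by
    intro i
    have hr : 0 < e (σ.symm i) / q i := by simpa using hratio (σ.symm i)
    exact Complex.ofReal_ne_zero.2 (Real.sqrt_pos.2 hr).ne'
  -- the normalised frame
  set X : Matrix (Fin 3) (Fin 3) ℂ := S * Matrix.diagonal fun i => (cs i : ℂ) with hX
  set V : Matrix (Fin 3) (Fin 3) ℂ := X.submatrix id σ with hV
  have hXdet : IsUnit X.det := by
    rw [hX, Matrix.det_mul, Matrix.det_diagonal]
    exact hS.mul (IsUnit.mk0 _ (Finset.prod_ne_zero_iff.2 fun i _ => hcs0 i))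
  have hVdet : IsUnit V.det := by
    rw [hV, Matrix.det_permute']
    exact (IsUnit.mk0 _ (by rw [Ne, Int.cast_eq_zero]; exact Units.ne_zero _)).mul hXdet
  -- `γ V = V diag(d ∘ σ)`
  have hGX : G * X = X * Matrix.diagonal d := by
    rw [hX, ← Matrix.mul_assoc, hGS, Matrix.mul_assoc, Matrix.mul_assoc, Matrix.diagonal_mul_diagonal, Matrix.diagonal_mul_diagonal]
    congr 2; funext i; ring
  have hGV : G * V = V * Matrix.diagonal fun ℓ => d (σ ℓ) := by
    rw [hV, mul_submatrix_id, hGX, ← Matrix.submatrix_mul_equiv X (Matrix.diagonal d) id σ σ, Matrix.submatrix_diagonal_equiv]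
    rfl
  -- `Vᴴ J V = J`
  have hXJX : Xᴴ * J * X = Matrix.diagonal fun i => (e (σ.symm i) : ℂ) := by
    have hstar : star (fun i => ((cs i : ℝ) : ℂ)) = fun i => ((cs i : ℝ) : ℂ) := funext fun i => Complex.conj_ofReal _
    rw [hX, Matrix.conjTranspose_mul, Matrix.diagonal_conjTranspose, hstar]
    calc Matrix.diagonal (fun i => ((cs i : ℝ) : ℂ)) * Sᴴ * J * (S * Matrix.diagonal fun i => ((cs i : ℝ) : ℂ))
        = Matrix.diagonal (fun i => ((cs i : ℝ) : ℂ)) * (Sᴴ * J * S) * Matrix.diagonal (fun i => ((cs i : ℝ) : ℂ)) := by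
          simp only [Matrix.mul_assoc]
      _ = Matrix.diagonal fun i => (e (σ.symm i) : ℂ) := by
          rw [← hQ, hQdiag, Matrix.diagonal_mul_diagonal, Matrix.diagonal_mul_diagonal]
          congr 1; funext i; exact hcs2 i
  have hVJV : Vᴴ * J * V = J := by
    rw [hV, conjTranspose_submatrix_mul_mul_submatrix, hXJX, Matrix.submatrix_diagonal_equiv, hJ]
    congr 1; funext ℓ; simp
  -- coordinates
  set c : Fin 3 → ℝ := fun k => Complex.arg (d (σ (τ k))) with hc
  have hC : ((gprimeCptGL τ c : GL (Fin 3) ℂ) : Matrix (Fin 3) (Fin 3) ℂ) = Matrix.diagonal fun ℓ => d (σ ℓ) := by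
    rw [coe_gprimeCptGL]
    congr 1
    funext ℓ
    have h := Complex.norm_mul_exp_arg_mul_I (d (σ ℓ))
    rw [hd1, Complex.ofReal_one, one_mul] at h
    rw [hc]
    simp only [Equiv.apply_symm_apply]
    exact h
  -- assemble
  refine ⟨Matrix.GeneralLinearGroup.mkOfDetNeZero V hVdet.ne_zero, ?_, c, ?_, ?_⟩
  · rw [mem_unitaryGroupOfForm_iff, transpose_map_starRingEnd_complex, Matrix.GeneralLinearGroup.val_mkOfDetNeZero]
    exact hVJV
  · intro i j hij
    have h : (Circle.exp (c i) : ℂ) = Circle.exp (c j) := congrArg (fun z : Circle => (z : ℂ)) hij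
    rw [Circle.coe_exp, Circle.coe_exp, hc] at h
    simp only at h
    have hi := Complex.norm_mul_exp_arg_mul_I (d (σ (τ i)))
    have hj := Complex.norm_mul_exp_arg_mul_I (d (σ (τ j)))
    rw [hd1, Complex.ofReal_one, one_mul] at hi hj
    rw [hi, hj] at h
    exact τ.injective (σ.injective (hdinj h))
  · refine Matrix.GeneralLinearGroup.ext fun i j => ?_
    rw [Units.val_mul, Units.val_mul, Matrix.coe_units_inv, Matrix.GeneralLinearGroup.val_mkOfDetNeZero, hC]
    have h : G = V * (Matrix.diagonal fun ℓ => d (σ ℓ)) * V⁻¹ := by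
      rw [← hGV, Matrix.mul_nonsing_inv_cancel_right _ _ hVdet]
    rw [← h]

end Compact

end Literature.NumberTheory.Automorphic.UnitaryGroup

end
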